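import Mathlib.Order.Filter.CountablyGenerated
import Mathlib.Topology.Algebra.Group.Basic
import Literature.AnabelianGeometry.SemiGraphs.TemperoidsHomHom

/-!
# [SemiAnbd] Theorem A.4 (chart route, Galois-countable case), step C-S1b: the homomorphism
# `Π₁ → Π₂` glued from a TORSOR TOWER below an open normal subgroup — Proposition 3.2's engine
# ported to the relative chart `T₂[A₂] = B^temp(Π₂)[Π₂/H₂]`

Mochizuki, *Semi-graphs of anabelioids*, Publ. RIMS **42** (2006) 221–322: Proposition 3.2
(manuscript p. 35) and Appendix, Theorem A.4 (pp. 82–86) [cite: MochizukiSemiAnbd2006, Prop 3.2 p.35]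
[cite: MochizukiSemiAnbd2006, Thm A.4 pp.82-86].  Proof-only tool file (no definitions, no named facts),
row C-S1b of `HOME/plan/L3/SUBDAG-SemiAnbd-Cor311.md` (abc-iut-L3-lead rulings μ3-1/ν3-1, chart route for
the RESTRICTED existence half of Thm. A.4 under Galois-countability = second countability, [IUTchI]
Rmk. 2.5.3 (ii) (E7)); seat abc-iut-w5-d220.

abc-iut-L3-d2's `BTemp.exists_continuousMonoidHom` (`TemperoidsHomHom.lean`) glues the continuous
homomorphism `φ : Π₁ → Π₂` of Prop. 3.2 from the torsors `F(Π₂/N)` of a functor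
`F : B^temp(Π₂) ⥤ B^temp(Π₁)` defined on ALL of `B^temp(Π₂)`.  In the proof of Thm. A.4 by charts the
functor is only defined on the full subcategory `T₂[A₂]` of objects admitting an arrow to
`A₂ = Π₂/H₂`, which contains the Galois objects `Π₂/N` only for `N ≤ H₂` (up to conjugacy).  THIS FILE
isolates the gluing step from the functor altogether: it runs on an abstract **torsor tower below a
fixed open normal subgroup `M₀`** —

* for every open normal `N ≤ M₀` an object `Y_N` of `B^temp(Π₁)` (in the application `F(Π₂/N)`),
* "projections" `pr : Y_N → Y_M` (`N ≤ M ≤ M₀`) and "right multiplications" `r_g : Y_N → Y_N`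
  (`g ∈ Π₂`) in `B^temp(Π₁)` satisfying the identities of `proj`/`rightMul` on the `Π₂/N`
  (`proj_self`, `proj_comp`, `rightMul_comp`, `rightMul_one`, `rightMul_eq_of_coe_eq`, `rightMul_proj`),
* the TORSOR hypotheses: each `Y_N` is nonempty, `Π₂` acts transitively on it through the `r_g`,
  `Π₂/N` acts freely (`r_g y = r_{g'} y ⇒ g ≡ g' mod N`), and the projections are surjective
  (these are what row C-S1a, abc-iut-w5-d106, proves for `F = φ^*|T₂[A₂]` from
  `PreservesNondegenerate` and the Galois splitting) —

and proves `exists_continuousMonoidHom_of_torsorTower`: for `Π₂` tempered and second countable there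
are a cofinal decreasing sequence `N_k ≤ M₀`, compatible base points `y_k ∈ Y_{N_k}` and a continuous
homomorphism `φ : Π₁ → Π₂` with `a · y_k = r_{φ(a)} y_k` for all `k`, `a` — verbatim the conclusion of
L3-d2's theorem, now available to the relative chart (instantiate `M₀ :=` any open normal subgroup of
`Π₂` inside `H₂`, which exists because the open normal subgroups form a basis of neighbourhoods of `1`,
Def. 3.1 (i)).  The proof is L3-d2's, transcribed step by step ((1) cofinal sequence, shifted below
`M₀`; (2) compatible base points; (3) the level maps `Π₁ → Π₂/N_k`; (4) gluing by completeness;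
(5) multiplicativity by separatedness; (6) continuity from the open stabiliser of `y_k`).
Nothing here refers to the IUT corpus; no side is taken on any disputed claim.
-/

namespace Literature.AnabelianGeometry.SemiGraphs

namespace BTemp

open CategoryTheory CategoryTheory.Limits Topology Filter

universe u

section Bookkeeping

variable {G : Type u} [Group G] [TopologicalSpace G]

/-- The action of a `Π`-set is multiplicative on elements. [folklore] -/
private theorem ρ_mul_apply₀ (X : BTemp G) (g h : G) (x : X.obj.V) :
    X.obj.ρ (g * h) x = X.obj.ρ g (X.obj.ρ h x) := by
  rw [map_mul]
  rfl

/-- The action of `1` is the identity on elements. [folklore] -/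
private theorem ρ_one_apply₀ (X : BTemp G) (x : X.obj.V) : X.obj.ρ 1 x = x := by
  rw [map_one]
  rfl

end Bookkeeping

variable {G₁ : Type u} [Group G₁] [TopologicalSpace G₁] [IsTopologicalGroup G₁]
  {G₂ : Type u} [Group G₂] [TopologicalSpace G₂] [IsTopologicalGroup G₂]
  [SecondCountableTopology G₂]

/-- **The homomorphism of Proposition 3.2, glued from a torsor tower below an open normal subgroup
`M₀`** (the engine of the chart route to [SemiAnbd] Thm. A.4 in the Galois-countable case).  Data:
objects `Y N hN` of `B^temp(Π₁)` for the open normal `N ≤ M₀` of `Π₂`, projections `pr` and right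
multiplications `r` with the identities of `Π₂/N`'s `proj`/`rightMul`; hypotheses: every `Y_N`
nonempty, `Π₂` transitive on it through `r`, `Π₂/N` free on it, projections surjective, `Π₂` tempered
and second countable.  Conclusion: a cofinal decreasing sequence `N_k ≤ M₀`, compatible base points
`y_k` and a continuous homomorphism `φ : Π₁ → Π₂` with `a · y_k = r_{φ(a)} y_k`.
[cite: MochizukiSemiAnbd2006, Prop 3.2 p.35] -/
theorem exists_continuousMonoidHom_of_torsorTower (hG₂ : IsTempered G₂) (M₀ : OpenNormalSubgroup G₂)
    (Y : ∀ N : OpenNormalSubgroup G₂, N ≤ M₀ → BTemp G₁)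
    (pr : ∀ {N M : OpenNormalSubgroup G₂} (hN : N ≤ M₀) (hM : M ≤ M₀), N ≤ M → (Y N hN ⟶ Y M hM))
    (r : ∀ {N : OpenNormalSubgroup G₂} (hN : N ≤ M₀), G₂ → (Y N hN ⟶ Y N hN))
    (pr_self : ∀ {N : OpenNormalSubgroup G₂} (hN : N ≤ M₀) (h : N ≤ N), pr hN hN h = 𝟙 (Y N hN))
    (pr_comp : ∀ {N M L : OpenNormalSubgroup G₂} (hN : N ≤ M₀) (hM : M ≤ M₀) (hL : L ≤ M₀)
      (h₁ : N ≤ M) (h₂ : M ≤ L), pr hN hM h₁ ≫ pr hM hL h₂ = pr hN hL (h₁.trans h₂))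
    (r_comp : ∀ {N : OpenNormalSubgroup G₂} (hN : N ≤ M₀) (a b : G₂),
      r hN a ≫ r hN b = r hN (a * b))
    (r_one : ∀ {N : OpenNormalSubgroup G₂} (hN : N ≤ M₀), r hN 1 = 𝟙 (Y N hN))
    (r_coe : ∀ {N : OpenNormalSubgroup G₂} (hN : N ≤ M₀) {a b : G₂},
      (a : G₂ ⧸ N.toSubgroup) = b → r hN a = r hN b)
    (r_pr : ∀ {N M : OpenNormalSubgroup G₂} (hN : N ≤ M₀) (hM : M ≤ M₀) (h : N ≤ M) (g : G₂),
      r hN g ≫ pr hN hM h = pr hN hM h ≫ r hM g)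
    (hne : ∀ {N : OpenNormalSubgroup G₂} (hN : N ≤ M₀), Nonempty (Y N hN).obj.V)
    (htrans : ∀ {N : OpenNormalSubgroup G₂} (hN : N ≤ M₀) (y y' : (Y N hN).obj.V),
      ∃ g : G₂, (r hN g).hom.hom y = y')
    (hfree : ∀ {N : OpenNormalSubgroup G₂} (hN : N ≤ M₀) {g g' : G₂} {y : (Y N hN).obj.V},
      (r hN g).hom.hom y = (r hN g').hom.hom y → (g : G₂ ⧸ N.toSubgroup) = g')
    (hsurj : ∀ {N M : OpenNormalSubgroup G₂} (hN : N ≤ M₀) (hM : M ≤ M₀) (h : N ≤ M)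
      (t : (Y M hM).obj.V), ∃ s : (Y N hN).obj.V, (pr hN hM h).hom.hom s = t) :
    ∃ (φ : G₁ →ₜ* G₂) (N : ℕ → OpenNormalSubgroup G₂) (hN : ∀ k, N k ≤ M₀)
      (y : ∀ k, (Y (N k) (hN k)).obj.V),
      Antitone N ∧ (∀ U ∈ 𝓝 (1 : G₂), ∃ k, (N k : Set G₂) ⊆ U) ∧
      (∀ j k, j ≤ k → ∀ h : N k ≤ N j, (pr (hN k) (hN j) h).hom.hom (y k) = y j) ∧
      ∀ (k : ℕ) (a : G₁), (Y (N k) (hN k)).obj.ρ a (y k) = (r (hN k) (φ a)).hom.hom (y k) := by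
  classical
  -- (1) a cofinal decreasing sequence of open normal subgroups, shifted below `M₀`
  obtain ⟨N', -, hNb'⟩ := hG₂.hasBasis_nhds_one.exists_antitone_subbasis
  have hNanti' : Antitone N' := fun j k hjk => SetLike.coe_subset_coe.mp (hNb'.antitone hjk)
  have hNbasis' : ∀ U ∈ 𝓝 (1 : G₂), ∃ k, (N' k : Set G₂) ⊆ U := fun U hU => hNb'.mem_iff.mp hU
  obtain ⟨k₀, hk₀⟩ : ∃ k₀, N' k₀ ≤ M₀ := by
    obtain ⟨k, hk⟩ := hNbasis' (M₀ : Set G₂) M₀.toOpenSubgroup.mem_nhds_one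
    exact ⟨k, SetLike.coe_subset_coe.mp hk⟩
  let N : ℕ → OpenNormalSubgroup G₂ := fun k => N' (k + k₀)
  have hNanti : Antitone N := fun j k hjk => hNanti' (Nat.add_le_add_right hjk k₀)
  have hN : ∀ k, N k ≤ M₀ := fun k => (hNanti' (Nat.le_add_left k₀ k)).trans hk₀
  have hNbasis : ∀ U ∈ 𝓝 (1 : G₂), ∃ k, (N k : Set G₂) ⊆ U := fun U hU => by
    obtain ⟨k, hk⟩ := hNbasis' U hU
    exact ⟨k, (SetLike.coe_subset_coe.mpr (hNanti' (Nat.le_add_right k k₀))).trans hk⟩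
  have hkU : ∀ M : OpenNormalSubgroup G₂, ∃ k, N k ≤ M := fun M => by
    obtain ⟨k, hk⟩ := hNbasis (M : Set G₂) M.toOpenSubgroup.mem_nhds_one
    exact ⟨k, SetLike.coe_subset_coe.mp hk⟩
  let kOf : OpenNormalSubgroup G₂ → ℕ := fun M => Classical.choose (hkU M)
  have hkOf : ∀ M, N (kOf M) ≤ M := fun M => Classical.choose_spec (hkU M)
  -- (2) compatible base points
  obtain ⟨y0⟩ := hne (hN 0)
  let y : ∀ k, (Y (N k) (hN k)).obj.V := fun k =>
    Nat.rec (motive := fun k => (Y (N k) (hN k)).obj.V) y0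
      (fun k yk => Classical.choose (hsurj (hN (k + 1)) (hN k) (hNanti (Nat.le_succ k)) yk)) k
  have hy : ∀ k, (pr (hN (k + 1)) (hN k) (hNanti (Nat.le_succ k))).hom.hom (y (k + 1)) = y k :=
    fun k => Classical.choose_spec (hsurj (hN (k + 1)) (hN k) (hNanti (Nat.le_succ k)) (y k))
  have hycompat : ∀ j k, j ≤ k → ∀ h : N k ≤ N j, (pr (hN k) (hN j) h).hom.hom (y k) = y j := by
    intro j k hjk
    induction k, hjk using Nat.le_induction with
    | base => intro h; rw [pr_self]; rfl
    | succ k hjk ih =>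
      intro h
      rw [← pr_comp (hN (k + 1)) (hN k) (hN j) (hNanti (Nat.le_succ k)) (hNanti hjk)]
      change (pr (hN k) (hN j) (hNanti hjk)).hom.hom
        ((pr (hN (k + 1)) (hN k) (hNanti (Nat.le_succ k))).hom.hom (y (k + 1))) = y j
      rw [hy k, ih]
  -- (3) the level-`k` maps `ψ k : Π₁ → Π₂` with `a · y_k = r_{ψ k a} y_k`
  let ψ : ℕ → G₁ → G₂ := fun k a =>
    Classical.choose (htrans (hN k) (y k) ((Y (N k) (hN k)).obj.ρ a (y k)))
  have hψ : ∀ k a, (r (hN k) (ψ k a)).hom.hom (y k) = (Y (N k) (hN k)).obj.ρ a (y k) :=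
    fun k a => Classical.choose_spec (htrans (hN k) (y k) ((Y (N k) (hN k)).obj.ρ a (y k)))
  have hψmul : ∀ k a b, ((ψ k (a * b) : G₂) : G₂ ⧸ (N k).toSubgroup) =
      ((ψ k a * ψ k b : G₂) : G₂ ⧸ (N k).toSubgroup) := by
    intro k a b
    apply hfree (hN k) (y := y k)
    rw [hψ k (a * b), ρ_mul_apply₀, ← hψ k b, ← hom_hom_ρ, ← hψ k a, ← r_comp]
    rfl
  have hψsucc : ∀ k a, ((ψ (k + 1) a : G₂) : G₂ ⧸ (N k).toSubgroup) = ψ k a := by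
    intro k a
    apply hfree (hN k) (y := y k)
    rw [hψ k a, ← hy k, ← hom_hom_ρ, ← hψ (k + 1) a]
    change (pr (hN (k + 1)) (hN k) (hNanti (Nat.le_succ k)) ≫ r (hN k) (ψ (k + 1) a)).hom.hom
        (y (k + 1)) =
      (r (hN (k + 1)) (ψ (k + 1) a) ≫ pr (hN (k + 1)) (hN k) (hNanti (Nat.le_succ k))).hom.hom (y (k + 1))
    rw [r_pr]
  have hcompat : ∀ j k, j ≤ k → ∀ a, ((ψ k a : G₂) : G₂ ⧸ (N j).toSubgroup) = ψ j a := by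
    intro j k hjk a
    induction k, hjk using Nat.le_induction with
    | base => rfl
    | succ k hjk ih =>
      rw [← ih, QuotientGroup.eq]
      have h1 := (QuotientGroup.eq (s := (N k).toSubgroup)).mp (hψsucc k a)
      exact hNanti hjk h1
  -- (4) glue the levels by completeness of `Π₂`
  have hcomplete : ∀ a : G₁, ∃ g : G₂, ∀ M : OpenNormalSubgroup G₂,
      ((ψ (kOf M) a : G₂) : G₂ ⧸ M.toSubgroup) = (g : G₂ ⧸ M.toSubgroup) := by
    intro a
    apply hG₂.complete (fun M => ((ψ (kOf M) a : G₂) : G₂ ⧸ M.toSubgroup))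
    intro M M' hMM' g hg
    rw [QuotientGroup.eq] at hg ⊢
    have h1 : (ψ (kOf M') a)⁻¹ * ψ (max (kOf M) (kOf M')) a ∈ M'.toSubgroup :=
      hkOf M' ((QuotientGroup.eq (s := (N (kOf M')).toSubgroup)).mp
        (hcompat _ _ (le_max_right (kOf M) (kOf M')) a).symm)
    have h2 : (ψ (max (kOf M) (kOf M')) a)⁻¹ * ψ (kOf M) a ∈ M'.toSubgroup :=
      hMM' (hkOf M ((QuotientGroup.eq (s := (N (kOf M)).toSubgroup)).mp
        (hcompat _ _ (le_max_left (kOf M) (kOf M')) a)))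
    have h3 : (ψ (kOf M) a)⁻¹ * g ∈ M'.toSubgroup := hMM' hg
    have h4 := M'.toSubgroup.mul_mem (M'.toSubgroup.mul_mem h1 h2) h3
    simpa only [mul_assoc, mul_inv_cancel_left] using h4
  let φfun : G₁ → G₂ := fun a => Classical.choose (hcomplete a)
  have hφ : ∀ a M, ((ψ (kOf M) a : G₂) : G₂ ⧸ M.toSubgroup) = (φfun a : G₂ ⧸ M.toSubgroup) :=
    fun a => Classical.choose_spec (hcomplete a)
  have hφψ : ∀ k a, ((φfun a : G₂) : G₂ ⧸ (N k).toSubgroup) = ψ k a := by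
    intro k a
    rw [← hφ a (N k)]
    have h1 : ((ψ (max k (kOf (N k))) a : G₂) : G₂ ⧸ (N k).toSubgroup) = ψ k a :=
      hcompat _ _ (le_max_left _ _) a
    have h2 : ((ψ (max k (kOf (N k))) a : G₂) : G₂ ⧸ (N (kOf (N k))).toSubgroup) =
        ψ (kOf (N k)) a :=
      hcompat _ _ (le_max_right _ _) a
    rw [← h1, QuotientGroup.eq]
    exact hkOf (N k) ((QuotientGroup.eq (s := (N (kOf (N k))).toSubgroup)).mp h2.symm)
  -- (5) `φ` is a homomorphism (by separatedness of `Π₂`)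
  have hφmul : ∀ a b, φfun (a * b) = φfun a * φfun b := by
    intro a b
    by_contra hne'
    have hne'' : (φfun a * φfun b)⁻¹ * φfun (a * b) ≠ 1 := by
      intro h
      apply hne'
      rw [inv_mul_eq_one] at h
      exact h.symm
    obtain ⟨M, hM⟩ := hG₂.separated _ hne''
    apply hM
    have h1 : ((φfun a * φfun b : G₂) : G₂ ⧸ (N (kOf M)).toSubgroup) =
        ((φfun (a * b) : G₂) : G₂ ⧸ (N (kOf M)).toSubgroup) := by
      rw [QuotientGroup.mk_mul, hφψ, hφψ, hφψ, ← QuotientGroup.mk_mul, hψmul]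
    exact hkOf M ((QuotientGroup.eq (s := (N (kOf M)).toSubgroup)).mp h1)
  let φ₀ : G₁ →* G₂ := MonoidHom.mk' φfun hφmul
  -- (6) `φ` is continuous (the stabiliser of `y_k` is open)
  have hcont : Continuous φ₀ := by
    apply continuous_of_continuousAt_one φ₀
    rw [ContinuousAt, map_one]
    refine (hG₂.hasBasis_nhds_one.tendsto_right_iff).mpr fun M _ => ?_
    have hopen : IsOpen {a : G₁ |
        (Y (N (kOf M)) (hN (kOf M))).obj.ρ a (y (kOf M)) = y (kOf M)} :=
      (Y (N (kOf M)) (hN (kOf M))).property.2 (y (kOf M))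
    have h1 : (1 : G₁) ∈ {a : G₁ |
        (Y (N (kOf M)) (hN (kOf M))).obj.ρ a (y (kOf M)) = y (kOf M)} :=
      ρ_one_apply₀ _ _
    filter_upwards [hopen.mem_nhds h1] with a ha
    have h2 : ((ψ (kOf M) a : G₂) : G₂ ⧸ (N (kOf M)).toSubgroup) = ((1 : G₂) : _) := by
      apply hfree (hN (kOf M)) (y := y (kOf M))
      rw [hψ, r_one]
      exact ha
    have h3 : φfun a ∈ (N (kOf M)).toSubgroup := by
      rw [← QuotientGroup.eq_one_iff, hφψ, h2, QuotientGroup.mk_one]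
    exact hkOf M h3
  -- (7) assemble
  refine ⟨⟨φ₀, hcont⟩, N, hN, y, hNanti, hNbasis, hycompat, fun k a => ?_⟩
  rw [← hψ k a]
  exact congrArg (fun f => (f : Y (N k) (hN k) ⟶ Y (N k) (hN k)).hom.hom (y k))
    (r_coe (hN k) (hφψ k a).symm)

/-! ### The tower of a functor on a full subcategory of `B^temp(Π₂)` containing the `Π₂/N`, `N ≤ M₀` -/

section Functor

variable (hG₂ : IsTempered G₂) {P : ObjectProperty (BTemp G₂)} (F : P.FullSubcategory ⥤ BTemp G₁)
  (M₀ : OpenNormalSubgroup G₂) (hP : ∀ N : OpenNormalSubgroup G₂, N ≤ M₀ → P (Q hG₂ N))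

omit [IsTopologicalGroup G₂] [SecondCountableTopology G₂] in
/-- In a full subcategory, `homMk` of an identity is the identity. [folklore] -/
private theorem homMk_id (X : P.FullSubcategory) :
    ObjectProperty.homMk (𝟙 X.obj) = 𝟙 X :=
  ObjectProperty.hom_ext _ rfl

omit [IsTopologicalGroup G₂] [SecondCountableTopology G₂] in
/-- In a full subcategory, `homMk` is compatible with composition. [folklore] -/
private theorem homMk_comp {X Y Z : P.FullSubcategory} (f : X.obj ⟶ Y.obj) (g : Y.obj ⟶ Z.obj) :
    ObjectProperty.homMk f ≫ ObjectProperty.homMk g = ObjectProperty.homMk (P := P) (f ≫ g) :=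
  ObjectProperty.hom_ext _ rfl

/-- **Proposition 3.2's homomorphism for a functor defined only on a full subcategory of
`B^temp(Π₂)`** that contains the Galois objects `Π₂/N` for the open normal `N` below some `M₀` — the
shape of the relative chart `T₂[A₂] = B^temp(Π₂)[Π₂/H₂]` of [SemiAnbd] Thm. A.4 (`P := admitsHomTo A₂`,
`M₀ :=` an open normal subgroup inside `H₂`).  Given the torsor facts for `F` on these objects
(nonempty, `Π₂`-transitive through `F(r_g)`, `Π₂/N`-free, `F` of the projections surjective — row
C-S1a), there are a cofinal decreasing sequence `N_k ≤ M₀`, compatible base points `y_k ∈ F(Π₂/N_k)`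
and a continuous homomorphism `φ : Π₁ → Π₂` with `a · y_k = F(r_{φ(a)}) y_k`: the conclusion of
abc-iut-L3-d2's `exists_continuousMonoidHom`, for `F` on the subcategory.
[cite: MochizukiSemiAnbd2006, Prop 3.2 p.35] -/
theorem exists_continuousMonoidHom_of_fullSubcategory
    (htrans : ∀ (N : OpenNormalSubgroup G₂) (hN : N ≤ M₀),
      Nonempty (F.obj ⟨Q hG₂ N, hP N hN⟩).obj.V ∧
      ∀ y y' : (F.obj ⟨Q hG₂ N, hP N hN⟩).obj.V, ∃ g : G₂,
        (F.map (ObjectProperty.homMk (rightMul hG₂ N g) :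
          (⟨Q hG₂ N, hP N hN⟩ : P.FullSubcategory) ⟶ ⟨Q hG₂ N, hP N hN⟩)).hom.hom y = y')
    (hfree : ∀ (N : OpenNormalSubgroup G₂) (hN : N ≤ M₀) {g g' : G₂}
      {y : (F.obj ⟨Q hG₂ N, hP N hN⟩).obj.V},
      (F.map (ObjectProperty.homMk (rightMul hG₂ N g) :
          (⟨Q hG₂ N, hP N hN⟩ : P.FullSubcategory) ⟶ ⟨Q hG₂ N, hP N hN⟩)).hom.hom y =
        (F.map (ObjectProperty.homMk (rightMul hG₂ N g') :
          (⟨Q hG₂ N, hP N hN⟩ : P.FullSubcategory) ⟶ ⟨Q hG₂ N, hP N hN⟩)).hom.hom y →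
      (g : G₂ ⧸ N.toSubgroup) = g')
    (hsurj : ∀ (N M : OpenNormalSubgroup G₂) (hN : N ≤ M₀) (hM : M ≤ M₀) (h : N ≤ M)
      (t : (F.obj ⟨Q hG₂ M, hP M hM⟩).obj.V), ∃ s : (F.obj ⟨Q hG₂ N, hP N hN⟩).obj.V,
      (F.map (ObjectProperty.homMk (proj hG₂ h) :
          (⟨Q hG₂ N, hP N hN⟩ : P.FullSubcategory) ⟶ ⟨Q hG₂ M, hP M hM⟩)).hom.hom s = t) :
    ∃ (φ : G₁ →ₜ* G₂) (N : ℕ → OpenNormalSubgroup G₂) (hN : ∀ k, N k ≤ M₀)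
      (y : ∀ k, (F.obj ⟨Q hG₂ (N k), hP (N k) (hN k)⟩).obj.V),
      Antitone N ∧ (∀ U ∈ 𝓝 (1 : G₂), ∃ k, (N k : Set G₂) ⊆ U) ∧
      (∀ j k, j ≤ k → ∀ h : N k ≤ N j,
        (F.map (ObjectProperty.homMk (proj hG₂ h) :
          (⟨Q hG₂ (N k), hP (N k) (hN k)⟩ : P.FullSubcategory) ⟶ ⟨Q hG₂ (N j), hP (N j) (hN j)⟩)).hom.hom
          (y k) = y j) ∧
      ∀ (k : ℕ) (a : G₁), (F.obj ⟨Q hG₂ (N k), hP (N k) (hN k)⟩).obj.ρ a (y k) =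
        (F.map (ObjectProperty.homMk (rightMul hG₂ (N k) (φ a)) :
          (⟨Q hG₂ (N k), hP (N k) (hN k)⟩ : P.FullSubcategory) ⟶ ⟨Q hG₂ (N k), hP (N k) (hN k)⟩)).hom.hom
          (y k) :=
  exists_continuousMonoidHom_of_torsorTower hG₂ M₀ (fun N hN => F.obj ⟨Q hG₂ N, hP N hN⟩)
    (fun hN hM h => F.map (ObjectProperty.homMk (proj hG₂ h)))
    (fun {N} hN g => F.map (ObjectProperty.homMk (rightMul hG₂ N g)))
    (fun hN h => by rw [proj_self, homMk_id, F.map_id])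
    (fun hN hM hL h₁ h₂ => by rw [← F.map_comp, homMk_comp, proj_comp])
    (fun hN a b => by rw [← F.map_comp, homMk_comp, rightMul_comp])
    (fun hN => by rw [rightMul_one, homMk_id, F.map_id])
    (fun hN a b hab => by rw [rightMul_eq_of_coe_eq hG₂ _ hab])
    (fun hN hM h g => by rw [← F.map_comp, ← F.map_comp, homMk_comp, homMk_comp, rightMul_proj])
    (fun hN => (htrans _ hN).1) (fun hN => (htrans _ hN).2) (fun hN => hfree _ hN)
    (fun hN hM h t => hsurj _ _ hN hM h t)

end Functor

end BTemp

end Literature.AnabelianGeometry.SemiGraphs
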